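import Mathlib.GroupTheory.SpecificGroups.Cyclic.Basic
import Mathlib.Data.Nat.Factorization.Basic
import Mathlib.NumberTheory.PrimesCongruentOne
import Mathlib.NumberTheory.Divisors
import Mathlib.Data.ZMod.Units
import Mathlib.RingTheory.IntegralDomain
import Mathlib.Analysis.SpecificLimits.Basic
import HarnessLib

/-!
# Elements of a cyclic group whose order is divisible by `n`, and primes `m ≡ 1 (mod nᵏ)`

Topic `Literature/NumberTheory/LFunctions`; namespace `Literature.NumberTheory.LFunctions.Chebotarev`.
Everything in this file is PROVED (theorems only).

The numerical input of "Chebotarëv's trick" in Chebotarev's original (class-field-theory-free)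
proof of his density theorem (N. Tschebotareff, Math. Ann. 95 (1926); Stevenhagen–Lenstra,
*Chebotarëv and his density theorem*, Math. Intelligencer 18 (1996), "Chebotarëv's proof"): for
an element `σ` of order `n` of `Gal(L/ℚ)` one adjoins `m`-th roots of unity, `m` prime, and uses
the pairs `(σ, τ)`, `τ ∈ Gal(ℚ(ζ_m)/ℚ) ≅ (ℤ/m)ˣ`, **whose second component has order divisible
by `n`**; the proportion of such `τ` must tend to `1` along a suitable sequence of primes `m`.

* `pow_eq_one_of_not_pow_dvd_orderOf`, `card_filter_not_pow_dvd_orderOf_le`,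
  `card_filter_not_dvd_orderOf_le`, `le_card_filter_dvd_orderOf` — in a finite cyclic group `G`
  with `nᵏ ∣ #G` (`k ≥ 1`), at most `n · #G / 2ᵏ` elements have order not divisible by `n`
  (an element whose order is not divisible by the exact power `ℓᵇ ∥ n` satisfies
  `τ ^ (ℓ^{b-1} · N') = 1`, `N'` the prime-to-`ℓ` part of `#G`, and a cyclic group has at most
  `e` solutions of `τᵉ = 1`, Mathlib `IsCyclic.card_pow_eq_one_le`).
* `exists_prime_card_units_orderOf_dvd` — **for `n ≥ 1`, `ε > 0` and any bound `N₀` there is a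
  prime `m > N₀` with `n ∣ m - 1` such that at least `(1 - ε)(m - 1)` units `τ ∈ (ℤ/m)ˣ` have
  order divisible by `n`** (primes `m ≡ 1 (mod nᵏ)` exist, Mathlib
  `Nat.exists_prime_gt_modEq_one`; `(ℤ/m)ˣ` is cyclic of order `m - 1`).

## References

* P. Stevenhagen, H. W. Lenstra, *Chebotarëv and his density theorem*, Math. Intelligencer 18
  (1996), no. 2, 26–37 ("Chebotarëv's proof"). [StevenhagenLenstra1996]
-/

noncomputable section

open scoped Classical

namespace Literature.NumberTheory.LFunctions.Chebotarev

section Cyclic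

variable {G : Type*} [Group G] [Fintype G]

/-- In a finite group `G`, if `ℓ` is prime and `ℓᵇ ∤ ord τ`, then `τ ^ (ℓ^{b-1} · N') = 1` where
`N' = ordCompl[ℓ] #G` is the prime-to-`ℓ` part of `#G` (write `ord τ = gcd(ord τ, ℓᵃ) ·
gcd(ord τ, N')` with `ℓᵃ ∥ #G`; the first factor is a power `ℓᶜ`, `c < b`). [folklore] -/
theorem pow_eq_one_of_not_pow_dvd_orderOf {ℓ b : ℕ} (hℓ : ℓ.Prime) (τ : G)
    (h : ¬ ℓ ^ b ∣ orderOf τ) : τ ^ (ℓ ^ (b - 1) * ordCompl[ℓ] (Fintype.card G)) = 1 := by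
  set N := Fintype.card G with hN
  have hN0 : N ≠ 0 := Fintype.card_ne_zero
  set d := orderOf τ with hd
  have hdN : d ∣ N := orderOf_dvd_card
  -- `gcd(d, ℓ^a) = ℓ^c` with `c < b`
  set a := N.factorization ℓ with ha
  obtain ⟨c, -, hc⟩ : ∃ c ≤ a, Nat.gcd d (ℓ ^ a) = ℓ ^ c :=
    (Nat.dvd_prime_pow hℓ).mp (Nat.gcd_dvd_right d (ℓ ^ a))
  have hcb : c < b := by
    by_contra hbc
    apply h
    calc ℓ ^ b ∣ ℓ ^ c := Nat.pow_dvd_pow ℓ (Nat.le_of_not_lt hbc)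
      _ = Nat.gcd d (ℓ ^ a) := hc.symm
      _ ∣ d := Nat.gcd_dvd_left _ _
  -- `d = gcd(d, ℓ^a) * gcd(d, N')` divides `ℓ^(b-1) * N'`
  have hcop : Nat.Coprime (ℓ ^ a) (ordCompl[ℓ] N) :=
    (Nat.coprime_ordCompl hℓ hN0).pow_left a
  have hsplit : ℓ ^ a * ordCompl[ℓ] N = N := Nat.ordProj_mul_ordCompl_eq_self N ℓ
  have hdeq : d = Nat.gcd d (ℓ ^ a) * Nat.gcd d (ordCompl[ℓ] N) := by
    rw [← Nat.Coprime.gcd_mul d hcop, hsplit]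
    exact (Nat.gcd_eq_left hdN).symm
  have hdvd : d ∣ ℓ ^ (b - 1) * ordCompl[ℓ] N := by
    rw [hdeq, hc]
    exact Nat.mul_dvd_mul (Nat.pow_dvd_pow ℓ (by omega)) (Nat.gcd_dvd_right _ _)
  exact orderOf_dvd_iff_pow_eq_one.mp hdvd

variable [IsCyclic G]

/-- In a finite cyclic group `G` with `ℓ^{kb} ∣ #G` (`ℓ` prime, `b, k ≥ 1`), at most `#G / 2ᵏ`
elements `τ` have `ℓᵇ ∤ ord τ`: they all satisfy `τᵉ = 1` with `e = ℓ^{b-1} N' ≤ #G / ℓᵏ`, and a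
cyclic group has at most `e` such elements (Mathlib `IsCyclic.card_pow_eq_one_le`). [folklore] -/
theorem card_filter_not_pow_dvd_orderOf_le {ℓ b k : ℕ} (hℓ : ℓ.Prime) (hb : 0 < b) (hk0 : 0 < k)
    (hk : k * b ≤ (Fintype.card G).factorization ℓ) :
    ((Finset.univ.filter fun τ : G ↦ ¬ ℓ ^ b ∣ orderOf τ).card : ℝ) ≤
      (Fintype.card G : ℝ) / 2 ^ k := by
  set N := Fintype.card G with hN
  have hN0 : N ≠ 0 := Fintype.card_ne_zero
  set a := N.factorization ℓ with ha
  set e := ℓ ^ (b - 1) * ordCompl[ℓ] N with he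
  have hN'0 : 0 < ordCompl[ℓ] N := Nat.ordCompl_pos ℓ hN0
  have he0 : 0 < e := Nat.mul_pos (pow_pos hℓ.pos _) hN'0
  -- the bad elements satisfy `τ ^ e = 1`, and there are at most `e` of those
  have hsub : (Finset.univ.filter fun τ : G ↦ ¬ ℓ ^ b ∣ orderOf τ) ⊆
      (Finset.univ.filter fun τ : G ↦ τ ^ e = 1) := by
    intro τ hτ
    simp only [Finset.mem_filter, Finset.mem_univ, true_and] at hτ ⊢
    exact pow_eq_one_of_not_pow_dvd_orderOf hℓ τ hτ
  have h1 : (Finset.univ.filter fun τ : G ↦ ¬ ℓ ^ b ∣ orderOf τ).card ≤ e :=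
    (Finset.card_le_card hsub).trans (IsCyclic.card_pow_eq_one_le he0)
  -- `e * 2^k ≤ N`
  have hbk : b - 1 + k ≤ a := by
    obtain ⟨k', rfl⟩ : ∃ k', k = k' + 1 := ⟨k - 1, by omega⟩
    obtain ⟨b', rfl⟩ : ∃ b', b = b' + 1 := ⟨b - 1, by omega⟩
    have : k' + b' + 1 ≤ (k' + 1) * (b' + 1) := by nlinarith [Nat.zero_le (k' * b')]
    omega
  have h2 : e * 2 ^ k ≤ N := by
    calc e * 2 ^ k = ℓ ^ (b - 1) * 2 ^ k * ordCompl[ℓ] N := by rw [he]; ring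
      _ ≤ ℓ ^ (b - 1) * ℓ ^ k * ordCompl[ℓ] N :=
          Nat.mul_le_mul_right _ (Nat.mul_le_mul_left _ (Nat.pow_le_pow_left hℓ.two_le k))
      _ = ℓ ^ (b - 1 + k) * ordCompl[ℓ] N := by rw [pow_add]
      _ ≤ ℓ ^ a * ordCompl[ℓ] N := Nat.mul_le_mul_right _ (Nat.pow_le_pow_right hℓ.pos hbk)
      _ = N := Nat.ordProj_mul_ordCompl_eq_self N ℓ
  rw [le_div_iff₀ (by positivity)]
  calc ((Finset.univ.filter fun τ : G ↦ ¬ ℓ ^ b ∣ orderOf τ).card : ℝ) * 2 ^ k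
      ≤ (e : ℝ) * 2 ^ k := mul_le_mul_of_nonneg_right (by exact_mod_cast h1) (by positivity)
    _ ≤ N := by exact_mod_cast h2

/-- In a finite cyclic group `G` with `nᵏ ∣ #G` (`n, k ≥ 1`), at most `n · #G / 2ᵏ` elements have
order not divisible by `n` (if `n ∤ ord τ` then `ℓᵇ ∤ ord τ` for some exact prime power `ℓᵇ ∥ n`,
Mathlib `Nat.dvd_iff_prime_pow_dvd_dvd`; sum `card_filter_not_pow_dvd_orderOf_le` over the at most
`n` prime factors of `n`). [folklore] -/
theorem card_filter_not_dvd_orderOf_le {n k : ℕ} (hn : 0 < n) (hk0 : 0 < k)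
    (hk : n ^ k ∣ Fintype.card G) :
    ((Finset.univ.filter fun τ : G ↦ ¬ n ∣ orderOf τ).card : ℝ) ≤
      n * ((Fintype.card G : ℝ) / 2 ^ k) := by
  set N := Fintype.card G with hN
  have hN0 : N ≠ 0 := Fintype.card_ne_zero
  -- bad ⊆ ⋃_{ℓ ∣ n} bad_ℓ
  have hsub : (Finset.univ.filter fun τ : G ↦ ¬ n ∣ orderOf τ) ⊆
      n.primeFactors.biUnion fun ℓ ↦
        Finset.univ.filter fun τ : G ↦ ¬ ℓ ^ (n.factorization ℓ) ∣ orderOf τ := by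
    intro τ hτ
    simp only [Finset.mem_filter, Finset.mem_univ, true_and] at hτ
    rw [Nat.dvd_iff_prime_pow_dvd_dvd] at hτ
    simp only [not_forall] at hτ
    obtain ⟨ℓ, j, hℓ, hjn, hjτ⟩ := hτ
    have hj0 : j ≠ 0 := by
      rintro rfl
      exact hjτ (by simp)
    have hℓn : ℓ ∣ n := (dvd_pow_self ℓ hj0).trans hjn
    simp only [Finset.mem_biUnion, Nat.mem_primeFactors, Finset.mem_filter, Finset.mem_univ,
      true_and]
    refine ⟨ℓ, ⟨hℓ, hℓn, hn.ne'⟩, fun h ↦ hjτ ?_⟩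
    have hjle : j ≤ n.factorization ℓ :=
      (Nat.Prime.pow_dvd_iff_le_factorization hℓ hn.ne').mp hjn
    exact (Nat.pow_dvd_pow ℓ hjle).trans h
  have h1 := Finset.card_le_card hsub
  have h2 := Finset.card_biUnion_le (s := n.primeFactors)
    (t := fun ℓ ↦ Finset.univ.filter fun τ : G ↦ ¬ ℓ ^ (n.factorization ℓ) ∣ orderOf τ)
  have h3 : ∀ ℓ ∈ n.primeFactors,
      ((Finset.univ.filter fun τ : G ↦ ¬ ℓ ^ (n.factorization ℓ) ∣ orderOf τ).card : ℝ) ≤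
        (N : ℝ) / 2 ^ k := by
    intro ℓ hℓ
    rw [Nat.mem_primeFactors] at hℓ
    obtain ⟨hℓp, hℓn, -⟩ := hℓ
    have hb : 0 < n.factorization ℓ := Nat.Prime.factorization_pos_of_dvd hℓp hn.ne' hℓn
    refine card_filter_not_pow_dvd_orderOf_le hℓp hb hk0 ?_
    have := (Nat.factorization_le_iff_dvd (pow_ne_zero k hn.ne') hN0).mpr hk
    have hkl := this ℓ
    rw [Nat.factorization_pow] at hkl
    simpa [mul_comm] using hkl
  have h4 : n.primeFactors.card ≤ n :=
    (Finset.card_le_card fun ℓ hℓ ↦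
      Nat.mem_divisors.mpr ⟨Nat.dvd_of_mem_primeFactors hℓ, hn.ne'⟩).trans
      (Nat.card_divisors_le_self n)
  calc ((Finset.univ.filter fun τ : G ↦ ¬ n ∣ orderOf τ).card : ℝ)
      ≤ ((n.primeFactors.biUnion fun ℓ ↦
          Finset.univ.filter fun τ : G ↦ ¬ ℓ ^ (n.factorization ℓ) ∣ orderOf τ).card : ℝ) := by
        exact_mod_cast h1
    _ ≤ ∑ ℓ ∈ n.primeFactors,
          ((Finset.univ.filter fun τ : G ↦ ¬ ℓ ^ (n.factorization ℓ) ∣ orderOf τ).card : ℝ) := by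
        exact_mod_cast h2
    _ ≤ ∑ ℓ ∈ n.primeFactors, (N : ℝ) / 2 ^ k := Finset.sum_le_sum h3
    _ = n.primeFactors.card * ((N : ℝ) / 2 ^ k) := by rw [Finset.sum_const, nsmul_eq_mul]
    _ ≤ n * ((N : ℝ) / 2 ^ k) :=
        mul_le_mul_of_nonneg_right (by exact_mod_cast h4) (by positivity)

/-- In a finite cyclic group `G` with `nᵏ ∣ #G` (`n, k ≥ 1`), at least `(1 - n/2ᵏ) · #G` elements
have order divisible by `n`. [folklore] -/
theorem le_card_filter_dvd_orderOf {n k : ℕ} (hn : 0 < n) (hk0 : 0 < k)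
    (hk : n ^ k ∣ Fintype.card G) :
    (1 - (n : ℝ) / 2 ^ k) * Fintype.card G ≤
      ((Finset.univ.filter fun τ : G ↦ n ∣ orderOf τ).card : ℝ) := by
  have hbad := card_filter_not_dvd_orderOf_le (G := G) hn hk0 hk
  have hsplit : (Finset.univ.filter fun τ : G ↦ n ∣ orderOf τ).card +
      (Finset.univ.filter fun τ : G ↦ ¬ n ∣ orderOf τ).card = Fintype.card G := by
    rw [Finset.card_filter_add_card_filter_not, Finset.card_univ]
  have hcast : ((Finset.univ.filter fun τ : G ↦ n ∣ orderOf τ).card : ℝ) =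
      Fintype.card G - ((Finset.univ.filter fun τ : G ↦ ¬ n ∣ orderOf τ).card : ℝ) := by
    rw [eq_sub_iff_add_eq]
    exact_mod_cast hsplit
  rw [hcast]
  have hring : (n : ℝ) * ((Fintype.card G : ℝ) / 2 ^ k) =
      (n : ℝ) / 2 ^ k * (Fintype.card G : ℝ) := by ring
  rw [hring] at hbad
  nlinarith [hbad]

end Cyclic

/-! ### Primes `m ≡ 1 (mod n^k)` and the units of `ZMod m` -/

/-- **Primes `m` for Chebotarëv's trick.** For `n ≥ 1`, `ε > 0` and every bound `N₀` there is a
prime `m > N₀` with `n ∣ m - 1` such that at least `(1 - ε) · (m - 1)` of the `m - 1` units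
`τ ∈ (ℤ/m)ˣ` have order divisible by `n`: take `k` with `n / 2ᵏ ≤ ε`, a prime
`m ≡ 1 (mod nᵏ)`, `m > N₀` (Mathlib `Nat.exists_prime_gt_modEq_one`), and apply
`le_card_filter_dvd_orderOf` to the cyclic group `(ℤ/m)ˣ` of order `m - 1`.  (In Chebotarev's
proof, Stevenhagen–Lenstra 1996, "Chebotarëv's proof", these `τ` index the auxiliary classes
`(σ, τ)` of `Gal(L(ζ_m)/ℚ) = G × (ℤ/m)ˣ` for which `L(ζ_m)` is a cyclotomic extension of the fixed
field of `(σ, τ)`.) [cite: StevenhagenLenstra1996, §"Chebotarëv's proof"] -/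
theorem exists_prime_card_units_orderOf_dvd (n : ℕ) (hn : 0 < n) {ε : ℝ} (hε : 0 < ε)
    (N₀ : ℕ) :
    ∃ m : ℕ, m.Prime ∧ N₀ < m ∧ n ∣ m - 1 ∧
      (1 - ε) * ((m : ℝ) - 1) ≤ Nat.card {τ : (ZMod m)ˣ // n ∣ orderOf τ} := by
  -- choose `k ≥ 1` with `n / 2^k ≤ ε`
  obtain ⟨k, hk0, hk⟩ : ∃ k : ℕ, 0 < k ∧ (n : ℝ) / 2 ^ k ≤ ε := by
    obtain ⟨K, hK⟩ := exists_nat_gt ((n : ℝ) / ε)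
    refine ⟨K + 1, Nat.succ_pos K, ?_⟩
    have h2K : (K : ℝ) + 1 ≤ (2 : ℝ) ^ (K + 1) := by
      have := Nat.lt_two_pow_self (n := K + 1)
      exact_mod_cast this.le
    rw [div_le_iff₀ (by positivity)]
    rw [div_lt_iff₀ hε] at hK
    nlinarith
  -- a prime `m > N₀` with `n^k ∣ m - 1`
  obtain ⟨m, hm, hmN, hmod⟩ := Nat.exists_prime_gt_modEq_one N₀ (pow_ne_zero k hn.ne')
  have hdvd : n ^ k ∣ m - 1 := (Nat.modEq_iff_dvd' hm.one_lt.le).mp hmod.symm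
  refine ⟨m, hm, hmN, (dvd_pow_self n hk0.ne').trans hdvd, ?_⟩
  haveI : Fact m.Prime := ⟨hm⟩
  have hcard : Fintype.card (ZMod m)ˣ = m - 1 := by
    rw [ZMod.card_units_eq_totient, Nat.totient_prime hm]
  have hG := le_card_filter_dvd_orderOf (G := (ZMod m)ˣ) hn hk0 (hcard ▸ hdvd)
  rw [hcard, Nat.cast_sub hm.one_lt.le, Nat.cast_one] at hG
  have hNat : Nat.card {τ : (ZMod m)ˣ // n ∣ orderOf τ} =
      (Finset.univ.filter fun τ : (ZMod m)ˣ ↦ n ∣ orderOf τ).card := by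
    rw [Nat.card_eq_fintype_card, Fintype.card_subtype]
  rw [hNat]
  have hm1 : (0 : ℝ) ≤ (m : ℝ) - 1 := by
    have : (1 : ℝ) ≤ m := by exact_mod_cast hm.one_lt.le
    linarith
  nlinarith [hG, hk, hm1, mul_nonneg (sub_nonneg.mpr hk) hm1]

end Literature.NumberTheory.LFunctions.Chebotarev
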